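import Mathlib
import HarnessLib
import Literature.Analysis.FluidPDE.SuitableWeak
import Literature.Analysis.FluidPDE.MildSolution
import Summits.NavierStokesRegularity.NavierStokesRegularity.Theses.AngularGalerkinLadder

/-! # BC3 skeleton (birth line, v4 = defect-gauge repair) for crux `NoOverheating`
(item stmt-NavierStokesRegularity-19960, route `route-NavierStokesRegularity-AngularGalerkinLadder` №8, card K2;
planner ns-blowup-plan g21, 2026-08-27)

WHY v4 (planner's own junk read of the registered v3 line, tree `Cruxes/NoOverheating/Lines/birth.lean` sha16
c09cdc0c0aca3944). In the route vocabulary a rung solution is a classical solution of Navier–Stokes FORCED by `d`,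
`∂ₜu + (u·∇)u = Δu − ∇p + d`, with `u t` band-limited and `d t` co-band-limited
(`AngularLadder.IsRungSolutionOn`); NOTHING ties `d` to `u` beyond the momentum identity, so the pair `(p, d)` carries a
GAUGE: `(p, d) ↦ (p + q, d + ∇q)` for any jointly smooth scalar `q` with `∇q(t,·)` co-band-limited. The v3 stub
`stub_defect_decay` quantified the scale-invariant defect bound over ALL `(u, p, d)` and is therefore FALSE by pure gauge:
* cheapest witness (`L = 0`): `u ≡ 0`, `p(t,x) = x₀`, `d ≡ e₀` — band-limited velocity, momentum `0 = −e₀ + e₀`, and the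
  constant field `e₀` is co-band-limited at level `0` (band-limited fields of degree `0` are the SO(3)-EQUIVARIANT compactly
  supported fields, whose integral is a rotation-invariant vector, i.e. `0`; tree road: `RungBlowupCofinalRungZeroNotSingular`
  machinery of K5-40, p484389); `IsRungProfile 0 C₀ c R 0 p d` holds for every `C₀ ≥ 0`, `c > 1`, `R`, while
  `HasDefectBound ε e₀` fails for every `ε` (let `t → −∞` at `x = 0`);
* at EVERY level `L`, even under an extra envelope hypothesis `HasDefectBound M d`: `u ≡ 0`, `q(t,x) = (−t)⁻¹ Q(x/√−t)` with
  `Q = φ(‖y‖)·(solid harmonic of degree L+2)`, `φ` a radial bump, normalised so that `sup_y ‖∇Q(y)‖(1+‖y‖)³ = 1`: then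
  `d := ∇q` is co-band-limited, `HasDefectBound 1 d` holds with equality somewhere, and `HasDefectBound ε_L d` fails as soon
  as `ε_L < 1`.
Class: stub-misstated (the ITEM `NoOverheating` is an `∃` over profiles and is untouched: one chooses the physical gauge;
`LimitTransfer` / hA′ carry the defect bound as a HYPOTHESIS and are untouched — KJ-24).

THE REPAIR: quantify only over profiles in the PHYSICAL GAUGE — the defect is DIVERGENCE-FREE on every past slice (as the
true Galerkin defect `(1 − Π_L) P (u·∇)u` is: `P` is the Leray projection and `Π_L` commutes with `div`) and lies in the
scale-invariant envelope class with SOME constant `M` (`HasDefectBound M d`). In that gauge the pressure part is pinned: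
for `u ≡ 0` the momentum identity gives `d = ∇p`, so `d(t,·)` is curl-free, div-free and → 0 at infinity, hence `0`
(tree `eq_of_curl_eq_zero_of_isDivFree_of_bounded`, `CurlFreeLiouville.lean`); for general `u` two physical-gauge
representations differ by a decaying harmonic gradient, i.e. not at all. Stub 1 now DELIVERS the gauge and a uniform
envelope `M` together with the window; stub 2 claims the defect SIZE `ε_L → 0` only inside that gauge. Honest strength
note: stub 2 is still a `∀` over all physical-gauge window profiles (stronger than the `∃` the crux needs); if a
near-cutoff family of rung profiles refutes it, the skeleton is re-cut selection-dependent (stub 2 restricted to the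
profiles produced by stub 1), not the item.

Stubs (2): `stub_uniform_typeI_window_physical` (XL), `stub_defect_decay_physical` (XL). Sorries ONLY inside `stub_*`;
`NoOverheating_of` is a real proof concluding `Goal`; the only theorem concluding the crux constant BY NAME is the
hypothesis-free `NoOverheating_skeleton` (A12 shape). New stub names (the junk record will be keyed to v3's
`stub_defect_decay`). WHAT THIS IS NOT: not NS — a registered plan; nothing about NS_L profiles is claimed. -/

set_option linter.dupNamespace false

namespace Summit.NavierStokesRegularity.NavierStokesRegularity.Cruxes.NoOverheating.Birth

open scoped Topology
open Filter Set MeasureTheory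
open Summit.NavierStokesRegularity.FluidComputer
open Literature.Analysis.FluidPDE

local notation "ℝ³" => EuclideanSpace ℝ (Fin 3)

/-- The crux, by name, behind a local abbreviation (A12 audit shape, as in v3). -/
abbrev Goal : Prop := Summit.NavierStokesRegularity.NavierStokesRegularity.Theses.AngularGalerkinLadder.NoOverheating

/-- **Physical gauge of a rung defect**: divergence-free on every past slice and inside the scale-invariant
envelope with constant `M` (`‖d(t,x)‖ ≤ M/(‖x‖+√−t)³`). -/
def InPhysicalGauge (M : ℝ) (d : ℝ → ℝ³ → ℝ³) : Prop :=
  (∀ t < 0, VectorCalculus.IsDivFree (d t)) ∧ AngularLadder.HasDefectBound M d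

/-- stub 1 (XL): UNIFORM TYPE-I WINDOW IN THE PHYSICAL GAUGE — singular rungs beyond some level carry profiles with a
common Type-I constant, DSS factor in a common compact window of `(1, ∞)`, a common amplitude floor at `t = −1`, and a
divergence-free defect inside a COMMON scale-invariant envelope `M` (no smallness claimed here). -/
theorem stub_uniform_typeI_window_physical :
    ∃ (C₀ cmin cmax δ M : ℝ) (L₀ : ℕ), 1 < cmin ∧ 0 < δ ∧ ∀ L ≥ L₀, AngularLadder.RungIsSingular L →
      ∃ (c : ℝ) (R : ℝ³ ≃ₗᵢ[ℝ] ℝ³) (u : ℝ → ℝ³ → ℝ³) (p : ℝ → ℝ³ → ℝ) (d : ℝ → ℝ³ → ℝ³),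
        AngularLadder.IsRungProfile L C₀ c R u p d ∧ cmin ≤ c ∧ c ≤ cmax ∧ (∃ x, δ ≤ ‖u (-1) x‖) ∧
          InPhysicalGauge M d := by
  sorry

/-- stub 2 (XL): DEFECT DECAY IN A WINDOW, PHYSICAL GAUGE — for rung profiles with Type-I constant `C₀`, factor in
`[cmin, cmax]` and a divergence-free defect in the envelope `M`, the defect obeys the scale-invariant bound with a size
`ε_L → 0` depending only on `(C₀, cmin, cmax, M)` (uniform angular regularity of Type-I rung profiles). -/
theorem stub_defect_decay_physical :
    ∀ C₀ cmin cmax M : ℝ, ∃ ε : ℕ → ℝ, Tendsto ε atTop (𝓝 0) ∧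
      ∀ (L : ℕ) (c : ℝ) (R : ℝ³ ≃ₗᵢ[ℝ] ℝ³) (u : ℝ → ℝ³ → ℝ³) (p : ℝ → ℝ³ → ℝ) (d : ℝ → ℝ³ → ℝ³),
        AngularLadder.IsRungProfile L C₀ c R u p d → cmin ≤ c → c ≤ cmax → InPhysicalGauge M d →
          AngularLadder.HasDefectBound (ε L) d := by
  sorry

/-- The crux BY NAME from the two stubs (real proof). -/
theorem NoOverheating_of
    (h1 : ∃ (C₀ cmin cmax δ M : ℝ) (L₀ : ℕ), 1 < cmin ∧ 0 < δ ∧ ∀ L ≥ L₀, AngularLadder.RungIsSingular L →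
      ∃ (c : ℝ) (R : ℝ³ ≃ₗᵢ[ℝ] ℝ³) (u : ℝ → ℝ³ → ℝ³) (p : ℝ → ℝ³ → ℝ) (d : ℝ → ℝ³ → ℝ³),
        AngularLadder.IsRungProfile L C₀ c R u p d ∧ cmin ≤ c ∧ c ≤ cmax ∧ (∃ x, δ ≤ ‖u (-1) x‖) ∧
          InPhysicalGauge M d)
    (h2 : ∀ C₀ cmin cmax M : ℝ, ∃ ε : ℕ → ℝ, Tendsto ε atTop (𝓝 0) ∧
      ∀ (L : ℕ) (c : ℝ) (R : ℝ³ ≃ₗᵢ[ℝ] ℝ³) (u : ℝ → ℝ³ → ℝ³) (p : ℝ → ℝ³ → ℝ) (d : ℝ → ℝ³ → ℝ³),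
        AngularLadder.IsRungProfile L C₀ c R u p d → cmin ≤ c → c ≤ cmax → InPhysicalGauge M d →
          AngularLadder.HasDefectBound (ε L) d) : Goal := by
  show Summit.NavierStokesRegularity.NavierStokesRegularity.Theses.AngularGalerkinLadder.NoOverheating
  obtain ⟨C₀, cmin, cmax, δ, M, L₀, hcmin, hδ, hwin⟩ := h1
  obtain ⟨ε, hε, hdef⟩ := h2 C₀ cmin cmax M
  refine ⟨C₀, cmin, cmax, δ, L₀, ε, hcmin, hδ, hε, fun L hL hs => ?_⟩
  obtain ⟨c, R, u, p, d, hprof, hc1, hc2, hx, hg⟩ := hwin L hL hs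
  exact ⟨c, R, u, p, d, hprof, hc1, hc2, hx, hdef L c R u p d hprof hc1 hc2 hg⟩

/-- The hypothesis-free skeleton line: carries the stubs' `sorry`s — decoration, not closure. -/
theorem NoOverheating_skeleton :
    Summit.NavierStokesRegularity.NavierStokesRegularity.Theses.AngularGalerkinLadder.NoOverheating :=
  NoOverheating_of stub_uniform_typeI_window_physical stub_defect_decay_physical

/-! ### Gauge facts (real proofs): why the physical gauge pins the defect. -/

/-- A scale-invariant envelope forces spatial decay on every past slice. -/
theorem HasDefectBound.tendsto_zero {M : ℝ} {d : ℝ → ℝ³ → ℝ³} (h : AngularLadder.HasDefectBound M d)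
    {t : ℝ} (ht : t < 0) :
    Tendsto (fun x : ℝ³ => ‖d t x‖) (Filter.comap (fun x : ℝ³ => ‖x‖) atTop) (𝓝 0) := by
  have h2 : Tendsto (fun r : ℝ => (r + Real.sqrt (-t)) ^ 3) atTop atTop :=
    (tendsto_pow_atTop three_ne_zero).comp (tendsto_atTop_add_const_right _ _ tendsto_id)
  have h1 : Tendsto (fun r : ℝ => M / (r + Real.sqrt (-t)) ^ 3) atTop (𝓝 0) :=
    Tendsto.div_atTop tendsto_const_nhds h2
  have henv : Tendsto (fun x : ℝ³ => M / (‖x‖ + Real.sqrt (-t)) ^ 3)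
      (Filter.comap (fun x : ℝ³ => ‖x‖) atTop) (𝓝 0) := h1.comp tendsto_comap
  refine squeeze_zero' (Eventually.of_forall fun x => norm_nonneg _) (Eventually.of_forall fun x => h t ht x) henv

/-- The envelope is a BOUND on every past slice. -/
theorem HasDefectBound.norm_le {M : ℝ} {d : ℝ → ℝ³ → ℝ³} (h : AngularLadder.HasDefectBound M d)
    {t : ℝ} (ht : t < 0) (x : ℝ³) : ‖d t x‖ ≤ |M| / Real.sqrt (-t) ^ 3 := by
  have hst : 0 < Real.sqrt (-t) := Real.sqrt_pos.2 (by linarith)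
  calc ‖d t x‖ ≤ M / (‖x‖ + Real.sqrt (-t)) ^ 3 := h t ht x
    _ ≤ |M| / (‖x‖ + Real.sqrt (-t)) ^ 3 :=
        div_le_div_of_nonneg_right (le_abs_self M) (by positivity)
    _ ≤ |M| / Real.sqrt (-t) ^ 3 := by
        apply div_le_div_of_nonneg_left (abs_nonneg M) (by positivity)
        exact pow_le_pow_left₀ hst.le (by linarith [norm_nonneg x]) 3

end Summit.NavierStokesRegularity.NavierStokesRegularity.Cruxes.NoOverheating.Birth
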